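import Mathlib
import HarnessLib
import Summits.Ventures.LatticeQCDFlow.Exactness.NCMCGeneralSpaceOccupancyChainErgodic
import Summits.Ventures.LatticeQCDFlow.Exactness.NCMCGeneralSpaceMarkovShift

/-!
# From almost every starting configuration: the NCMC chain launched at a `ν₀`-typical prior state has consistent occupancy and `dF_occ`

HONEST FRAMING: exact (Metropolis-corrected) sampling algorithms for lattice gauge theory;
figures of merit are autocorrelation/cost numbers at stated couplings and volumes; no
continuum-physics claim.

Venture `LatticeQCDFlow` (cell pub-lqcd), topic `Exactness`; FANOUT row 13 (`eng-snf`, GEN-17).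
NEW WORK of the cell, not a published result; no definition is introduced; nothing is cited as a
fact.  The sampling statements of GEN-16/17 are along the chain STARTED IN ITS INVARIANT LAW
(`Kernel.trajMeasure π κ`); the engine starts `run_ncmc_chain` from ONE configuration (after
thermalisation).  This file disintegrates the stationary chain over its initial state — Mathlib's
`Kernel.trajMeasure μ κ = (traj κ 0) ∘ₘ μ` read pointwise through GEN-16's
`NCMCGeneralSpaceMarkovShift.trajMeasure_dirac` — so that every almost-sure statement along the
stationary chain holds along the chain started at `π`-ALMOST EVERY point; for the expanded ensemble,
`π_c`-almost every prior state means `ν₀`-almost every configuration.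

## Content

* §1 (any Markov kernel on `S`): **`trajMeasure_apply_eq_lintegral_dirac`** —
  `P_μ(A) = ∫ P_{δ_z}(A) dμ(z)`; **`ae_ae_trajMeasure_dirac_of_ae`** — an almost-sure property of
  paths under `P_μ` holds `P_{δ_z}`-almost surely for `μ`-almost every start `z`.
* §2 `ae_prior_of_ae_jointLaw` / `ae_target_of_ae_jointLaw` — a `π_c`-almost-sure property of
  expanded-ensemble states holds at `(prior, x)` for `ν₀`-a.e. `x` and at `(target, y)` for
  `ν₁`-a.e. `y` (`Z₀ ≠ 0`).
* §3 **`CrooksPair.ae_start_occupancy_dFocc_ncmcChain`** — under GEN-17's certificate (Crooks pair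
  between finite non-zero weights, level samplers invariant and minorised by non-zero measures, any
  `c`): for `ν₀`-ALMOST EVERY initial configuration `x`, along the NCMC chain started at `(prior, x)`
  the occupancy fraction converges to `σ(c − ΔF)` and `dF_occ,n` to `ΔF` almost surely.

NOT CLAIMED: EVERY starting point (false in this generality: the switch kernel has atoms and a
deterministic protocol can trap an exceptional null set of starts); anything quantitative about
thermalisation (`n_therm`).
-/

namespace Summit.Ventures.LatticeQCDFlow.Exactness.GeneralNCMC

open MeasureTheory ProbabilityTheory Set Filter Finset
open scoped ENNReal Topology

/-! ## §1 Disintegrating the chain over its initial state -/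

section Start

variable {S : Type*} [MeasurableSpace S] (κ : Kernel S S) [IsMarkovKernel κ]

/-- **`P_μ(A) = ∫ P_{δ_z}(A) dμ(z)`**: the chain from an initial law is the mixture of the chains
from points. -/
theorem trajMeasure_apply_eq_lintegral_dirac (μ : Measure S) {A : Set (ℕ → S)}
    (hA : MeasurableSet A) :
    Kernel.trajMeasure (X := fun _ : ℕ => S) μ
        (fun n : ℕ => κ.comap (fun h : (j : ↥(Finset.Iic n)) → S => h ⟨n, Finset.mem_Iic.2 le_rfl⟩)
          (measurable_pi_apply _)) A =
      ∫⁻ z, Kernel.trajMeasure (X := fun _ : ℕ => S) (Measure.dirac z)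
        (fun n : ℕ => κ.comap (fun h : (j : ↥(Finset.Iic n)) → S => h ⟨n, Finset.mem_Iic.2 le_rfl⟩)
          (measurable_pi_apply _)) A ∂μ := by
  simp_rw [trajMeasure_dirac κ]
  rw [Kernel.trajMeasure, Measure.bind_apply hA (Kernel.aemeasurable _),
    lintegral_map (Kernel.measurable_coe _ hA) (MeasurableEquiv.measurable _)]

/-- **Almost sure along the chain from `μ` ⇒ almost sure along the chain from `μ`-almost every
point.** -/
theorem ae_ae_trajMeasure_dirac_of_ae {μ : Measure S} {p : (ℕ → S) → Prop}
    (h : ∀ᵐ x ∂(Kernel.trajMeasure (X := fun _ : ℕ => S) μ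
      (fun n : ℕ => κ.comap (fun h : (j : ↥(Finset.Iic n)) → S => h ⟨n, Finset.mem_Iic.2 le_rfl⟩)
        (measurable_pi_apply _))), p x) :
    ∀ᵐ z ∂μ, ∀ᵐ x ∂(Kernel.trajMeasure (X := fun _ : ℕ => S) (Measure.dirac z)
      (fun n : ℕ => κ.comap (fun h : (j : ↥(Finset.Iic n)) → S => h ⟨n, Finset.mem_Iic.2 le_rfl⟩)
        (measurable_pi_apply _))), p x := by
  rw [ae_iff] at h
  obtain ⟨N, hsub, hN, hN0⟩ := exists_measurable_superset_of_null h
  rw [trajMeasure_apply_eq_lintegral_dirac κ μ hN,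
    lintegral_eq_zero_iff (measurable_trajMeasure_dirac κ hN)] at hN0
  filter_upwards [hN0] with z hz
  rw [ae_iff]
  exact measure_mono_null hsub hz

end Start

/-! ## §2 `π_c`-almost every state, level by level -/

section JointLaw

variable {Ω : Type*} [MeasurableSpace Ω] (c : ℝ) (ν₀ ν₁ : Measure Ω) [IsFiniteMeasure ν₀]
  [IsFiniteMeasure ν₁]

/-- A `π_c`-almost-sure property holds at `(prior, x)` for `ν₀`-almost every `x`. -/
theorem ae_prior_of_ae_jointLaw {p : Bool × Ω → Prop}
    (h : ∀ᵐ z ∂((jointWeight c ν₀ ν₁ univ)⁻¹ • jointWeight c ν₀ ν₁), p z) :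
    ∀ᵐ x ∂ν₀, p (false, x) := by
  haveI := isFiniteMeasure_jointWeight c ν₀ ν₁
  rw [ae_iff] at h ⊢
  obtain ⟨N, hsub, hN, hN0⟩ := exists_measurable_superset_of_null h
  rw [jointLaw_apply_eq_zero_iff c ν₀ ν₁, jointWeight_apply c ν₀ ν₁ hN, add_eq_zero] at hN0
  exact measure_mono_null (fun x (hx : ¬ p (false, x)) => hsub hx) hN0.1

/-- A `π_c`-almost-sure property holds at `(target, y)` for `ν₁`-almost every `y`. -/
theorem ae_target_of_ae_jointLaw {p : Bool × Ω → Prop}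
    (h : ∀ᵐ z ∂((jointWeight c ν₀ ν₁ univ)⁻¹ • jointWeight c ν₀ ν₁), p z) :
    ∀ᵐ y ∂ν₁, p (true, y) := by
  haveI := isFiniteMeasure_jointWeight c ν₀ ν₁
  rw [ae_iff] at h ⊢
  obtain ⟨N, hsub, hN, hN0⟩ := exists_measurable_superset_of_null h
  rw [jointLaw_apply_eq_zero_iff c ν₀ ν₁, jointWeight_apply c ν₀ ν₁ hN, add_eq_zero,
    mul_eq_zero] at hN0
  exact measure_mono_null (fun y (hy : ¬ p (true, y)) => hsub hy)
    (hN0.2.resolve_left (by rw [ENNReal.ofReal_eq_zero, not_le]; exact Real.exp_pos c))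

end JointLaw

/-! ## §3 The NCMC chain from `ν₀`-almost every initial configuration -/

namespace CrooksPair

variable {Ω E : Type*} [MeasurableSpace Ω] [MeasurableSpace E]
variable {ν₀ ν₁ : Measure Ω} [IsFiniteMeasure ν₀] [IsFiniteMeasure ν₁] {κF κR : Kernel Ω E}
  [IsMarkovKernel κF] [IsMarkovKernel κR] {s e : E → Ω} {W : E → ℝ} {T₀ T₁ : Kernel Ω Ω}
  [IsMarkovKernel T₀] [IsMarkovKernel T₁] {m₀ m₁ : Measure Ω} [IsFiniteMeasure m₀] [IsFiniteMeasure m₁]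

/-- **FROM `ν₀`-ALMOST EVERY INITIAL CONFIGURATION.**  Under the certificate (Crooks pair between
finite non-zero weights; level samplers `T₀`, `T₁` leaving `ν₀`, `ν₁` invariant and minorised by
non-zero measures; any `c`): for `ν₀`-almost every `x`, along the expanded-ensemble chain of
`switchKernel ∘ₖ levelKernel T₀ T₁` STARTED AT THE PRIOR STATE `(prior, x)`, the occupancy fraction
converges to `σ(c − ΔF)` and `dF_occ,n = c − log(p̂_n/(1 − p̂_n))` converges to `ΔF`, almost
surely. -/
theorem ae_start_occupancy_dFocc_ncmcChain (h : CrooksPair ν₀ ν₁ κF κR s e W) (h0 : ν₀ univ ≠ 0)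
    (h1 : ν₁ univ ≠ 0) (hT₀ : Kernel.Invariant T₀ ν₀) (hT₁ : Kernel.Invariant T₁ ν₁)
    (hm₀ : m₀ univ ≠ 0) (hm₁ : m₁ univ ≠ 0) (hmin₀ : ∀ z, m₀ ≤ T₀ z) (hmin₁ : ∀ z, m₁ ≤ T₁ z)
    (c : ℝ) {ΔF : ℝ} (hΔF : Real.exp (-ΔF) = ((ν₀ univ)⁻¹ * ν₁ univ).toReal) :
    haveI := isMarkovKernel_switchKernel (κF := κF) (κR := κR) (c := c)
      h.measurable_W h.measurable_s h.measurable_e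
    haveI := isMarkovKernel_levelKernel T₀ T₁
    ∀ᵐ x ∂ν₀, ∀ᵐ z ∂(Kernel.trajMeasure (X := fun _ : ℕ => Bool × Ω)
        (Measure.dirac ((false, x) : Bool × Ω))
        (fun n : ℕ => (switchKernel κF κR c W s e ∘ₖ levelKernel T₀ T₁).comap
          (fun hh : (j : ↥(Finset.Iic n)) → Bool × Ω => hh ⟨n, Finset.mem_Iic.2 le_rfl⟩)
          (measurable_pi_apply _))),
      Tendsto (fun n : ℕ => (∑ i ∈ range n, (targetLevel Ω).indicator (1 : Bool × Ω → ℝ) (z i)) / n)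
          atTop (𝓝 (Real.sigmoid (c - ΔF))) ∧
        Tendsto (fun n : ℕ => c - Real.log
            ((∑ i ∈ range n, (targetLevel Ω).indicator (1 : Bool × Ω → ℝ) (z i)) / n /
              (1 - (∑ i ∈ range n, (targetLevel Ω).indicator (1 : Bool × Ω → ℝ) (z i)) / n)))
          atTop (𝓝 ΔF) := by
  haveI := isMarkovKernel_switchKernel (κF := κF) (κR := κR) (c := c)
    h.measurable_W h.measurable_s h.measurable_e
  haveI := isMarkovKernel_levelKernel T₀ T₁
  haveI := isProbabilityMeasure_jointLaw c ν₀ ν₁ h0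
  have hstat := (h.tendsto_occupancy_ae_ncmcChain h0 h1 hT₀ hT₁ hm₀ hm₁ hmin₀ hmin₁ c hΔF).and
    (h.tendsto_dFocc_ae_ncmcChain h0 h1 hT₀ hT₁ hm₀ hm₁ hmin₀ hmin₁ c hΔF)
  exact ae_prior_of_ae_jointLaw c ν₀ ν₁ (ae_ae_trajMeasure_dirac_of_ae _ hstat)

end CrooksPair

end Summit.Ventures.LatticeQCDFlow.Exactness.GeneralNCMC
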